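import Literature.AlgebraicGeometry.GroupSchemes.AdmissibleIdealSpecialFibre
import Literature.AlgebraicGeometry.GroupSchemes.EtaleIdealEqPointsIdeal
import HarnessLib

/-!
# Specialisation is ONTO the admissible ideals of the special fibre («SP-SURJ»): every admissible subgroup of the `w`-block downstairs is a
# specialised line ([Tate1997FiniteFlatGroupSchemes] (3.7); [Liu2021] p. 136; [EGAIV2] 2.8.5)

Topic `Literature/AlgebraicGeometry/GroupSchemes`; namespace `Literature.AlgebraicGeometry.GroupSchemes.AdmSpecialFibreSurj`.  THEOREMS ONLY (no
definition, no instance, no notation, no named fact, no `sorry`).  Cell `hodgecm-mathlib` (D-0151), programme P6 «MOD» (crux hLiu418 =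
stmt-HodgeConjecture-24832, `--supports`, count-neutral): generic organ **«SP-SURJ» (ii)** for the D-line `Lines/F0_P6a_DatumOfInputs.lean` socket
`stub_DOWN` ∕ `stub_SPEC` (cut memo `MEMO-DLINE-cut.v1.F0P6c-plan-g4` row G8; desk F0P6c-plan (g4) (Q-lift) ruling 2026-09-02T01:25:17Z: «NO
DEFAULT VALUE — `sp y : LineOf I y → SubOf I 𝔡 (red₀ y)` is SURJECTIVE for every lift `y` of `x̄`», so `quot x̄ H := red₀ (quotΩ y L)` for ANY
`(y, L)` over `(x̄, H)`).  Sequel of ★ (S1) `AdmissibleIdealSpecialFibre` (`spI` carries admissibles to admissibles), ★ (E-b4′)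
`CanonicalLineAssembly` (exactly one admissible line specialises to the Frobenius kernel), ★ (K-b) `ClosedSubgroupDichotomyHopf` (admissible
downstairs ⇒ `kerFI` or étale) and ★ `EtaleIdealEqPointsIdeal` (the étale admissible ideal of corank `#𝒢(κ)` is unique).  HC_CM is proved only
modulo the printed citations until rung 0 closes; this file is generic and changes no count.

THE PRINT.  [Tate1997FiniteFlatGroupSchemes] (3.7) ∕ [Liu2021] p. 136: for the `w`-block `𝒢 = 𝒢_y[ϖ]` (finite flat of rank `q²` over `𝒪_Ω̄`,
generic fibre étale with `q + 1` stable lines `H_β`) the specialisation of a line is its flat closure read on the special fibre ([EGAIV2] 2.8.5; ★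
`spI`).  At an ORDINARY reduction `x̄` (`#𝒢_x̄(κ̄) = q`) the admissible subgroups of `𝒢_x̄` are exactly two — the connected `Ker F` and the étale
`𝒢_red` —, the canonical line is the only one specialising to `Ker F`, so the other `q` lines specialise to the étale one; at a SUPERSINGULAR `x̄`
(`#𝒢_x̄(κ̄) = 1`) `Ker F` is the only admissible subgroup and every line specialises to it.  Either way `sp : {lines} → {admissible subgroups of
𝒢_x̄}` is ONTO.

## Contents (all in the ★ Hopf-ideal currency «`I.IsHopfIdeal ∧ corank r ∧ β-stable`» of `AdmissibleIdealSpecialFibre`∕`CanonicalLineAssembly`)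
* §1 the logical skeletons `exists_eq_of_canonical_of_dichotomy` (ordinary) and `exists_eq_of_dichotomy_of_not_etale` (supersingular), any types;
* §2 `finrank_quotient_le_natCard_algHom` ∕ **`finrank_quotient_le_natCard_sections`**: an étale quotient has `dim ≤ #points` — no ideal of corank
  `r` is étale when `#G(k) < r`;
* §3 HEADS **`exists_admissible_spI_eq_of_ordinary`** (`#𝒢_κ(κ) = r`; hypotheses: the canonical line exists and is unique for a reference ideal
  `K₀` — ★ (E-b4′) —, some admissible `L ≠ L₀` upstairs, the dichotomy «`= K₀` or étale» downstairs — ★ (K-b)) and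
  **`exists_admissible_spI_eq_of_supersingular`** (`#𝒢_κ(κ) < r`; one admissible upstairs + the dichotomy).

## References
* [Tate1997FiniteFlatGroupSchemes] J. Tate, *Finite flat group schemes*, in: Modular Forms and Fermat's Last Theorem (1997), (3.7).
* [Liu2021] Y. Liu, *Fourier–Jacobi cycles and arithmetic relative trace formula*, Camb. J. Math. 9 (2021), p. 136 (ordinary points, canonical line).
* [EGAIV2] A. Grothendieck, J. Dieudonné, *ÉGA* IV₂, Publ. Math. IHÉS 24 (1965), Prop. 2.8.5 (flat closure over a valuation ring).
* [StacksProject] The Stacks Project, Tag 00U3 (étale algebras over separably closed fields split).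
-/

set_option autoImplicit false

-- Mathlib's `Over`/`Scheme` APIs are stated across semireducible wrappers (as in the ★ `GroupSchemes/*` files).
set_option backward.isDefEq.respectTransparency false

universe u

open CategoryTheory CategoryTheory.Limits AlgebraicGeometry MonoidalCategory CartesianMonoidalCategory TensorProduct
open scoped MonObj CategoryTheory.Obj

noncomputable section

namespace Literature.AlgebraicGeometry.GroupSchemes

namespace AdmSpecialFibreSurj

/-! ## §1 The skeleton of the argument (pure logic) -/

/-- **SURJECTIVITY OF SPECIALISATION FROM «CANONICAL LINE + DICHOTOMY + ÉTALE UNIQUENESS»** (the logical skeleton, any types): a map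
`sp : α → β` carrying admissibles to admissibles, a reference admissible `K₀ ∈ β` hit by EXACTLY ONE admissible `L₀` (existence and uniqueness
of the canonical line), at least one admissible `L ≠ L₀`, the dichotomy «admissible ⇒ `= K₀` or étale» downstairs and the uniqueness of the étale
admissible — then EVERY admissible element of `β` is `sp` of an admissible element of `α`. [cite: Tate1997FiniteFlatGroupSchemes, (3.7)]
[cite: Liu2021, p. 136] -/
theorem exists_eq_of_canonical_of_dichotomy {α β : Type*} (sp : α → β) (AdmK : α → Prop) (Admκ : β → Prop) (Et : β → Prop) (K₀ : β)
    (hsp : ∀ L, AdmK L → Admκ (sp L))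
    (hcanE : ∃ L₀, AdmK L₀ ∧ sp L₀ = K₀) (hcanU : ∀ L L', AdmK L → AdmK L' → sp L = K₀ → sp L' = K₀ → L = L')
    (htwo : ∀ L₀, AdmK L₀ → ∃ L, AdmK L ∧ L ≠ L₀)
    (hdich : ∀ I, Admκ I → I = K₀ ∨ Et I) (hEt : ∀ I I', Admκ I → Admκ I' → Et I → Et I' → I = I')
    (I : β) (hI : Admκ I) : ∃ L, AdmK L ∧ sp L = I := by
  obtain ⟨L₀, hL₀, hsp₀⟩ := hcanE
  rcases hdich I hI with rfl | hIet
  · exact ⟨L₀, hL₀, hsp₀⟩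
  · obtain ⟨L, hL, hne⟩ := htwo L₀ hL₀
    refine ⟨L, hL, ?_⟩
    have hspL : sp L ≠ K₀ := fun h => hne (hcanU L L₀ hL hL₀ h hsp₀)
    rcases hdich (sp L) (hsp L hL) with h | hLet
    · exact absurd h hspL
    · exact (hEt I (sp L) hI (hsp L hL) hIet hLet).symm

/-- **THE SUPERSINGULAR SKELETON**: if NO admissible element of `β` is étale (e.g. too few points), the dichotomy forces every admissible to be
`K₀`, and `sp` is onto the admissibles as soon as ONE admissible element of `α` exists. [cite: Tate1997FiniteFlatGroupSchemes, (3.7)] -/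
theorem exists_eq_of_dichotomy_of_not_etale {α β : Type*} (sp : α → β) (AdmK : α → Prop) (Admκ : β → Prop) (Et : β → Prop) (K₀ : β)
    (hsp : ∀ L, AdmK L → Admκ (sp L)) (hone : ∃ L, AdmK L)
    (hdich : ∀ I, Admκ I → I = K₀ ∨ Et I) (hnet : ∀ I, Admκ I → ¬ Et I)
    (I : β) (hI : Admκ I) : ∃ L, AdmK L ∧ sp L = I := by
  obtain ⟨L, hL⟩ := hone
  refine ⟨L, hL, ?_⟩
  have h1 : I = K₀ := (hdich I hI).resolve_right (hnet I hI)
  have h2 : sp L = K₀ := (hdich (sp L) (hsp L hL)).resolve_right (hnet _ (hsp L hL))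
  rw [h1, h2]

/-! ## §2 Étale quotients are bounded by the point count -/

section Count

open Literature.AlgebraicGeometry.Motives AffineGroupScheme

variable {k : Type u} [Field k] [IsSepClosed k]

/-- An étale quotient `A ⧸ I` over a separably closed field has `dim_k (A ⧸ I) ≤ #Hom_k(A, k)` (its `dim` characters are distinct characters of
`A`; ★ `EtaleIdealPoints.exists_injective_algHom_of_etale`). [cite: StacksProject, Tag 00U3] [cite: Tate1997FiniteFlatGroupSchemes, (3.7)] -/
theorem finrank_quotient_le_natCard_algHom {A : Type u} [CommRing A] [Algebra k A] (I : Ideal A) [Algebra.Etale k (A ⧸ I)]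
    [Finite (A →ₐ[k] k)] : Module.finrank k (A ⧸ I) ≤ Nat.card (A →ₐ[k] k) := by
  obtain ⟨χ, hinj, -, -, hc⟩ := EtaleIdealPoints.exists_injective_algHom_of_etale (k := k) I
  rw [← hc]
  exact Nat.card_le_card_of_injective χ hinj

/-- **Scheme currency**: for `G` finite over a separably closed field and `I ⊂ Γ(G)` with `Spec (Γ(G) ⧸ I) → Spec k` étale,
`dim_k (Γ(G) ⧸ I) ≤ #(𝟙_ ⟶ G)` — so NO ideal of corank `r` is étale when `#G(k) < r` (the supersingular `w`-block: `#𝒢(k̄) = 1 < q`).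
[cite: Tate1997FiniteFlatGroupSchemes, (3.7)] [cite: StacksProject, Tag 00U3] -/
theorem finrank_quotient_le_natCard_sections (G : SchemeOver k) [IsAffine G.left] [IsFinite G.hom] (I : Ideal (Alg G))
    (hI : Etale (specOver k (Alg G ⧸ I)).hom) : Module.finrank k (Alg G ⧸ I) ≤ Nat.card (𝟙_ (SchemeOver k) ⟶ G) := by
  haveI := EtaleIdealPoints.algebraEtale_of_etale_specOver_quotient G I hI
  haveI : Finite (Alg G →ₐ[k] k) := EtaleIdealPoints.finite_algHom_of_isFinite G
  rw [natCard_sections_eq_natCard_algHom G]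
  exact finrank_quotient_le_natCard_algHom I

end Count

/-! ## §3 HEAD: `sp` is ONTO the admissible ideals of the special fibre -/

section Head

open Literature.AlgebraicGeometry.Motives AffineGroupScheme

variable {R : Type u} [CommRing R] [IsDomain R] [ValuationRing R] (K κ : Type u) [Field K] [Algebra R K] [IsFractionRing R K]
  [Field κ] [Algebra R κ] [IsSepClosed κ]
  (G : SchemeOver R) [GrpObj G] [IsAffine G.left] [Module.Finite R (Alg G)]
  [IsAffine ((Over.pullback (Spec.map (CommRingCat.ofHom (algebraMap R K)))).obj G).left]
  [IsAffine ((Over.pullback (Spec.map (CommRingCat.ofHom (algebraMap R κ)))).obj G).left]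
  [IsFinite ((Over.pullback (Spec.map (CommRingCat.ofHom (algebraMap R κ)))).obj G).hom]
  {σ : Type*} (β : σ → (G ⟶ G)) (r : ℕ)

/-- **SP-SURJ AT AN ORDINARY POINT — every admissible ideal of the special fibre is the specialisation of an admissible ideal of the generic
fibre.**  SETTING (★ `AdmissibleIdealSpecialFibre`): `R` a valuation ring with fraction field `K`, `κ` a SEPARABLY CLOSED field over `R` (the
residue field `κ̄(w)`), `𝒢` an affine module-finite group scheme over `R` with endomorphisms `β a`, `r ∈ ℕ`; «admissible» = Hopf ideal of corank `r`
stable under every `Γ(β a)` (upstairs in `Γ(𝒢_K)`, downstairs in `Γ(𝒢_κ)`); `sp = spI` (★).  HYPOTHESES — exactly what the P6 HEART has at an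
ORDINARY `w`-block: (`hpts`) `#𝒢_κ(κ) = r`; (`hcanE`∕`hcanU`) a reference admissible `K₀ ⊂ Γ(𝒢_κ)` (print: the Frobenius-kernel ideal `kerFI`) is
the specialisation of EXACTLY ONE admissible `L₀` (★ (E-b4′) `CanonicalLine.existsUnique_admK_spI_eq_kerFI`); (`htwo`) some admissible `L ≠ L₀`
upstairs (the `q + 1 ≥ 3` lines); (`hdich`) downstairs every admissible ideal is `K₀` or étale (★ (K-b) `eq_or_etale_of_isHopfIdeal_of_stable`).
CONCLUSION: every admissible `I ⊂ Γ(𝒢_κ)` is `spI L` for an admissible `L` — `sp : Line y ↠ Sub (red₀ y)` (D-line `stub_SPEC`, P6c (g4) (Q-lift)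
ruling 2026-09-02).  Proof: §1 skeleton with `hsp` = ★ `isHopfIdeal_and_finrank_and_map_le_spI` and `hEt` = ★ `EtaleIdealPoints.
eq_of_etale_of_finrank_eq_natCard_sections` (two étale admissible ideals of corank `#𝒢_κ(κ)` coincide).
[cite: Tate1997FiniteFlatGroupSchemes, (3.7)] [cite: Liu2021, p. 136] [cite: EGAIV2, Prop. 2.8.5] -/
theorem exists_admissible_spI_eq_of_ordinary
    (hpts : Nat.card (𝟙_ (SchemeOver κ) ⟶ (Over.pullback (Spec.map (CommRingCat.ofHom (algebraMap R κ)))).obj G) = r)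
    (K₀ : Ideal (Alg ((Over.pullback (Spec.map (CommRingCat.ofHom (algebraMap R κ)))).obj G)))
    (hcanE : ∃ L₀ : Ideal (Alg ((Over.pullback (Spec.map (CommRingCat.ofHom (algebraMap R K)))).obj G)),
      (L₀.IsHopfIdeal K ∧ Module.finrank K (Alg ((Over.pullback (Spec.map (CommRingCat.ofHom (algebraMap R K)))).obj G) ⧸ L₀) = r ∧
        ∀ a, L₀.map ((Over.pullback (Spec.map (CommRingCat.ofHom (algebraMap R K)))).map (β a)).left.appTop.hom ≤ L₀) ∧ spI K κ G L₀ = K₀)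
    (hcanU : ∀ L L' : Ideal (Alg ((Over.pullback (Spec.map (CommRingCat.ofHom (algebraMap R K)))).obj G)),
      (L.IsHopfIdeal K ∧ Module.finrank K (Alg ((Over.pullback (Spec.map (CommRingCat.ofHom (algebraMap R K)))).obj G) ⧸ L) = r ∧
        ∀ a, L.map ((Over.pullback (Spec.map (CommRingCat.ofHom (algebraMap R K)))).map (β a)).left.appTop.hom ≤ L) →
      (L'.IsHopfIdeal K ∧ Module.finrank K (Alg ((Over.pullback (Spec.map (CommRingCat.ofHom (algebraMap R K)))).obj G) ⧸ L') = r ∧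
        ∀ a, L'.map ((Over.pullback (Spec.map (CommRingCat.ofHom (algebraMap R K)))).map (β a)).left.appTop.hom ≤ L') →
      spI K κ G L = K₀ → spI K κ G L' = K₀ → L = L')
    (htwo : ∀ L₀ : Ideal (Alg ((Over.pullback (Spec.map (CommRingCat.ofHom (algebraMap R K)))).obj G)),
      (L₀.IsHopfIdeal K ∧ Module.finrank K (Alg ((Over.pullback (Spec.map (CommRingCat.ofHom (algebraMap R K)))).obj G) ⧸ L₀) = r ∧
        ∀ a, L₀.map ((Over.pullback (Spec.map (CommRingCat.ofHom (algebraMap R K)))).map (β a)).left.appTop.hom ≤ L₀) →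
      ∃ L : Ideal (Alg ((Over.pullback (Spec.map (CommRingCat.ofHom (algebraMap R K)))).obj G)),
        (L.IsHopfIdeal K ∧ Module.finrank K (Alg ((Over.pullback (Spec.map (CommRingCat.ofHom (algebraMap R K)))).obj G) ⧸ L) = r ∧
          ∀ a, L.map ((Over.pullback (Spec.map (CommRingCat.ofHom (algebraMap R K)))).map (β a)).left.appTop.hom ≤ L) ∧ L ≠ L₀)
    (hdich : ∀ I : Ideal (Alg ((Over.pullback (Spec.map (CommRingCat.ofHom (algebraMap R κ)))).obj G)),
      (I.IsHopfIdeal κ ∧ Module.finrank κ (Alg ((Over.pullback (Spec.map (CommRingCat.ofHom (algebraMap R κ)))).obj G) ⧸ I) = r ∧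
        ∀ a, I.map ((Over.pullback (Spec.map (CommRingCat.ofHom (algebraMap R κ)))).map (β a)).left.appTop.hom ≤ I) →
      I = K₀ ∨ Etale (specOver κ (Alg ((Over.pullback (Spec.map (CommRingCat.ofHom (algebraMap R κ)))).obj G) ⧸ I)).hom)
    (I : Ideal (Alg ((Over.pullback (Spec.map (CommRingCat.ofHom (algebraMap R κ)))).obj G)))
    (hI : I.IsHopfIdeal κ ∧ Module.finrank κ (Alg ((Over.pullback (Spec.map (CommRingCat.ofHom (algebraMap R κ)))).obj G) ⧸ I) = r ∧
      ∀ a, I.map ((Over.pullback (Spec.map (CommRingCat.ofHom (algebraMap R κ)))).map (β a)).left.appTop.hom ≤ I) :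
    ∃ L : Ideal (Alg ((Over.pullback (Spec.map (CommRingCat.ofHom (algebraMap R K)))).obj G)),
      (L.IsHopfIdeal K ∧ Module.finrank K (Alg ((Over.pullback (Spec.map (CommRingCat.ofHom (algebraMap R K)))).obj G) ⧸ L) = r ∧
        ∀ a, L.map ((Over.pullback (Spec.map (CommRingCat.ofHom (algebraMap R K)))).map (β a)).left.appTop.hom ≤ L) ∧ spI K κ G L = I := by
  refine exists_eq_of_canonical_of_dichotomy (spI K κ G) _ _
    (fun I => Etale (specOver κ (Alg ((Over.pullback (Spec.map (CommRingCat.ofHom (algebraMap R κ)))).obj G) ⧸ I)).hom) K₀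
    (fun L hL => isHopfIdeal_and_finrank_and_map_le_spI K κ G β r L hL) hcanE hcanU htwo hdich (fun I I' hI hI' hIet hI'et => ?_) I hI
  exact EtaleIdealPoints.eq_of_etale_of_finrank_eq_natCard_sections _ I I' hIet hI'et (hI.2.1.trans hpts.symm) (hI'.2.1.trans hpts.symm)

/-- **SP-SURJ AT A SUPERSINGULAR POINT** (`#𝒢_κ(κ) < r`, print: `#𝒢(k̄) = 1`): no admissible ideal downstairs is étale (§2), so the dichotomy
makes every admissible ideal the reference `K₀` (`= kerFI`), and `sp` is onto as soon as ONE admissible ideal exists upstairs.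
[cite: Tate1997FiniteFlatGroupSchemes, (3.7)] [cite: Liu2021, p. 136] [cite: EGAIV2, Prop. 2.8.5] -/
theorem exists_admissible_spI_eq_of_supersingular
    (hpts : Nat.card (𝟙_ (SchemeOver κ) ⟶ (Over.pullback (Spec.map (CommRingCat.ofHom (algebraMap R κ)))).obj G) < r)
    (K₀ : Ideal (Alg ((Over.pullback (Spec.map (CommRingCat.ofHom (algebraMap R κ)))).obj G)))
    (hone : ∃ L : Ideal (Alg ((Over.pullback (Spec.map (CommRingCat.ofHom (algebraMap R K)))).obj G)),
      L.IsHopfIdeal K ∧ Module.finrank K (Alg ((Over.pullback (Spec.map (CommRingCat.ofHom (algebraMap R K)))).obj G) ⧸ L) = r ∧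
        ∀ a, L.map ((Over.pullback (Spec.map (CommRingCat.ofHom (algebraMap R K)))).map (β a)).left.appTop.hom ≤ L)
    (hdich : ∀ I : Ideal (Alg ((Over.pullback (Spec.map (CommRingCat.ofHom (algebraMap R κ)))).obj G)),
      (I.IsHopfIdeal κ ∧ Module.finrank κ (Alg ((Over.pullback (Spec.map (CommRingCat.ofHom (algebraMap R κ)))).obj G) ⧸ I) = r ∧
        ∀ a, I.map ((Over.pullback (Spec.map (CommRingCat.ofHom (algebraMap R κ)))).map (β a)).left.appTop.hom ≤ I) →
      I = K₀ ∨ Etale (specOver κ (Alg ((Over.pullback (Spec.map (CommRingCat.ofHom (algebraMap R κ)))).obj G) ⧸ I)).hom)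
    (I : Ideal (Alg ((Over.pullback (Spec.map (CommRingCat.ofHom (algebraMap R κ)))).obj G)))
    (hI : I.IsHopfIdeal κ ∧ Module.finrank κ (Alg ((Over.pullback (Spec.map (CommRingCat.ofHom (algebraMap R κ)))).obj G) ⧸ I) = r ∧
      ∀ a, I.map ((Over.pullback (Spec.map (CommRingCat.ofHom (algebraMap R κ)))).map (β a)).left.appTop.hom ≤ I) :
    ∃ L : Ideal (Alg ((Over.pullback (Spec.map (CommRingCat.ofHom (algebraMap R K)))).obj G)),
      (L.IsHopfIdeal K ∧ Module.finrank K (Alg ((Over.pullback (Spec.map (CommRingCat.ofHom (algebraMap R K)))).obj G) ⧸ L) = r ∧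
        ∀ a, L.map ((Over.pullback (Spec.map (CommRingCat.ofHom (algebraMap R K)))).map (β a)).left.appTop.hom ≤ L) ∧ spI K κ G L = I := by
  refine exists_eq_of_dichotomy_of_not_etale (spI K κ G) _ _
    (fun I => Etale (specOver κ (Alg ((Over.pullback (Spec.map (CommRingCat.ofHom (algebraMap R κ)))).obj G) ⧸ I)).hom) K₀
    (fun L hL => isHopfIdeal_and_finrank_and_map_le_spI K κ G β r L hL) hone hdich (fun I hI hIet => ?_) I hI
  have h := finrank_quotient_le_natCard_sections ((Over.pullback (Spec.map (CommRingCat.ofHom (algebraMap R κ)))).obj G) I hIet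
  rw [hI.2.1] at h
  omega

end Head

end AdmSpecialFibreSurj

end Literature.AlgebraicGeometry.GroupSchemes

end
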